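import Literature.Probability.Percolation.KSTPeriodicStatements
import Literature.Probability.Percolation.KSTPeriodicSymmetry
import Literature.Probability.Percolation.RSW
import HarnessLib

/-!
# KST-type RSW for periodic measures: long connections from translated arches

Topic `Literature/Probability/Percolation`. The first case of the proof of
[KohlerSchindlerTassion2023, Lemma 1] ("bridges imply crossings") for `kℤ² ⋊ D₄`-periodic
positively associated measures (`Admissible k t μ`, `KSTPeriodicDefs.lean`), as pure statements
about open connections:

* `arch_of_parts`: in a rectangle, a connection from the left part of the boundary to the
  bottom-right segment and one from the right part to the bottom-left segment give an *arch*, a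
  connection between the two bottom segments (`𝓔 ∩ v·𝓔 ⊆ 𝓕`; planar input
  `PartsToSegmentsMeet`); in probability `μ(𝓔) μ(v𝓔) ≤ μ(𝓕)` (`mul_le_real_arch`);
* `exists_openConnIn_of_arches`: a family of arches above a row whose feet march to the right
  (left foot of the `j`-th at abscissa `≤ p + js`, right foot at `≥ q + js`, `p + s < q`) contains
  a connection from `{x₀ ≤ p}` to `{q + Js ≤ x₀}` (planar input `ArchesMeet`: the component of
  the arch reaching furthest right also reaches furthest left);
* `exists_openConnIn_of_iInter_arches`, `pow_le_real_iInter_shift`: the same for the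
  intersection of `J + 1` translates of the arch event by multiples of a vector of `kℤ²`, and the
  FKG lower bound `μ(𝓕)^(J+1)` for that intersection.

## References

* [KohlerSchindlerTassion2023] L. Köhler-Schindler, V. Tassion, *Crossing probabilities for
  planar percolation*, Duke Math. J. 172 (2023) 809–838, §3 (proof of Lemma 1, Fig. 6).
-/

namespace Literature.Probability.Percolation

open _root_.MeasureTheory LatticeModels

noncomputable section

namespace KSTPeriodic

/-! ### Arches from crossed connections -/

/-- **`𝓔 ∩ v·𝓔 ⊆ 𝓕`.** In `[L, R] × [B, T]` with `L ≤ xl < xr ≤ R`, `B < T`: for a lattice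
configuration, an open connection from the left part of the boundary (left column, or top/bottom
row at abscissa `≤ xl`) to the bottom-right segment `{x₁ = B, xr ≤ x₀}` together with one from the
right part to the bottom-left segment `{x₁ = B, x₀ ≤ xl}` gives an open connection between the two
bottom segments. [cite: KohlerSchindlerTassion2023, §3, proof of Lemma 1 (first case)] -/
theorem arch_of_parts (hPS : PartsToSegmentsMeet) {ω : BondConfig (Site 2)}
    (hω : ω ⊆ (zdGraph 2).edgeSet) {L R B T xl xr : ℤ} (hl : L ≤ xl) (hlr : xl < xr) (hr : xr ≤ R)
    (hBT : B < T)
    (h₁ : ω ∈ openCrossing (rect L R B T)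
      {x | x ∈ rect L R B T ∧ (x 0 = L ∨ ((x 1 = T ∨ x 1 = B) ∧ x 0 ≤ xl))}
      {y | y ∈ rect L R B T ∧ y 1 = B ∧ xr ≤ y 0})
    (h₂ : ω ∈ openCrossing (rect L R B T)
      {x | x ∈ rect L R B T ∧ (x 0 = R ∨ ((x 1 = T ∨ x 1 = B) ∧ xr ≤ x 0))}
      {y | y ∈ rect L R B T ∧ y 1 = B ∧ y 0 ≤ xl}) :
    ω ∈ openCrossing (rect L R B T) {y | y ∈ rect L R B T ∧ y 1 = B ∧ y 0 ≤ xl}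
      {y | y ∈ rect L R B T ∧ y 1 = B ∧ xr ≤ y 0} := by
  classical
  obtain ⟨x, ⟨hxR, hx⟩, y, hy, hxy⟩ := h₁
  -- if the first connection starts on the bottom-left segment we are done
  by_cases hxB : x 1 = B ∧ x 0 ≤ xl
  · exact ⟨x, ⟨hxR, hxB⟩, y, hy, hxy⟩
  obtain ⟨x', ⟨hx'R, hx'⟩, y', hy', hx'y'⟩ := h₂
  by_cases hx'B : x' 1 = B ∧ xr ≤ x' 0
  · exact ⟨y', hy', x', ⟨hx'R, hx'B⟩, by rwa [openConnIn_comm]⟩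
  -- otherwise the two connections cross
  have hx1 : x 0 = L ∨ (x 1 = T ∧ x 0 ≤ xl) := by
    rcases hx with h | ⟨h | h, h'⟩
    · exact Or.inl h
    · exact Or.inr ⟨h, h'⟩
    · exact absurd ⟨h, h'⟩ hxB
  have hx'1 : x' 0 = R ∨ (x' 1 = T ∧ xr ≤ x' 0) := by
    rcases hx' with h | ⟨h | h, h'⟩
    · exact Or.inl h
    · exact Or.inr ⟨h, h'⟩
    · exact absurd ⟨h, h'⟩ hx'B
  obtain ⟨P₁, hP₁S, hP₁ω⟩ := exists_walk_of_mem_openConnIn hω hxy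
  obtain ⟨P₂, hP₂S, hP₂ω⟩ := exists_walk_of_mem_openConnIn hω hx'y'
  obtain ⟨z, hz₁, hz₂⟩ := hPS L R B T xl xr x y x' y' P₁ P₂ hl hlr hr hBT
    (fun z hz => hP₁S z hz) (fun z hz => hP₂S z hz) hx1 hy.2.1 hy.2.2 hx'1 hy'.2.1 hy'.2.2
  -- `y' ↔ z` along the second walk, `z ↔ y` along the first
  have e₁ : ω ∈ openConnIn (rect L R B T) y' z := by
    have h1 := mem_openConnIn_of_mem_support P₂ hP₂S hP₂ω hz₂
    rw [openConnIn_comm] at hx'y'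
    exact PlanarDuality.openConnIn_trans hx'y' h1
  have e₂ : ω ∈ openConnIn (rect L R B T) z y := by
    have h1 := mem_openConnIn_of_mem_support P₁ hP₁S hP₁ω hz₁
    rw [openConnIn_comm] at h1
    exact PlanarDuality.openConnIn_trans h1 hxy
  exact ⟨y', hy', y, hy, PlanarDuality.openConnIn_trans e₁ e₂⟩

variable {k t : ℕ} {μ : Measure (BondConfig (Site 2))}

/-- **`μ(𝓔) μ(v𝓔) ≤ μ(𝓕)`**: probability form of `arch_of_parts` for a positively associated
measure carried by lattice configurations (FKG for the two increasing events).
[cite: KohlerSchindlerTassion2023, §3, proof of Lemma 1 (first case)] -/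
theorem mul_le_real_arch [IsProbabilityMeasure μ] (hμ : Admissible k t μ) (hL : LatticeCarried μ)
    (hPS : PartsToSegmentsMeet) {L R B T xl xr : ℤ} (hl : L ≤ xl) (hlr : xl < xr) (hr : xr ≤ R)
    (hBT : B < T) :
    μ.real (openCrossing (rect L R B T)
        {x | x ∈ rect L R B T ∧ (x 0 = L ∨ ((x 1 = T ∨ x 1 = B) ∧ x 0 ≤ xl))}
        {y | y ∈ rect L R B T ∧ y 1 = B ∧ xr ≤ y 0}) *
      μ.real (openCrossing (rect L R B T)
        {x | x ∈ rect L R B T ∧ (x 0 = R ∨ ((x 1 = T ∨ x 1 = B) ∧ xr ≤ x 0))}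
        {y | y ∈ rect L R B T ∧ y 1 = B ∧ y 0 ≤ xl}) ≤
      μ.real (openCrossing (rect L R B T) {y | y ∈ rect L R B T ∧ y 1 = B ∧ y 0 ≤ xl}
        {y | y ∈ rect L R B T ∧ y 1 = B ∧ xr ≤ y 0}) := by
  refine (mul_le_real_inter hμ (isUpperSet_openCrossing _ _ _) (isUpperSet_openCrossing _ _ _)
    (measurableSet_openCrossing_of_countable _ _ _) (measurableSet_openCrossing_of_countable _ _ _)).trans ?_
  refine ENNReal.toReal_mono (measure_ne_top _ _) (measure_mono_ae ?_)
  filter_upwards [hL] with ω hω h using arch_of_parts hPS hω hl hlr hr hBT h.1 h.2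

/-! ### A long connection from a family of arches -/

/-- **Marching arches join up.** Above the row `lo` (inside a set `S ⊆ {lo ≤ x₁}`) let, for
`j = 0, …, J`, the points `a j`, `c j` of the row `lo` be joined by an open path inside `S`, with
`(a j)₀ ≤ p + js` and `q + js ≤ (c j)₀`, where `p < q`, `p + s < q` (consecutive arches overlap
but need not interleave). Then `S` contains an open connection from `{x₀ ≤ p}` to `{q + Js ≤ x₀}`:
the open component of the right foot reaching furthest to the right has its leftmost foot at
abscissa `≤ p`, for otherwise, by `ArchesMeet`, every arch starting left of that foot also ends
left of it, inductively for all `j`. [cite: KohlerSchindlerTassion2023, §3, proof of Lemma 1 (first case, Fig. 6)] -/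
theorem exists_openConnIn_of_arches (hAr : ArchesMeet) {ω : BondConfig (Site 2)}
    (hω : ω ⊆ (zdGraph 2).edgeSet) {S : Set (Site 2)} {lo : ℤ} (hS : ∀ z ∈ S, lo ≤ z 1)
    {p q s : ℤ} (hpq : p < q) (hps : p + s < q) {J : ℕ} {a c : ℕ → Site 2}
    (ha1 : ∀ j ≤ J, a j 1 = lo) (hc1 : ∀ j ≤ J, c j 1 = lo)
    (ha0 : ∀ j ≤ J, a j 0 ≤ p + j * s) (hc0 : ∀ j ≤ J, q + j * s ≤ c j 0)
    (hconn : ∀ j ≤ J, ω ∈ openConnIn S (a j) (c j)) :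
    ∃ x y, x 0 ≤ p ∧ q + J * s ≤ y 0 ∧ ω ∈ openConnIn S x y := by
  classical
  have hmemJ : ∀ {j}, j ∈ Finset.range (J + 1) ↔ j ≤ J := by simp
  -- the arch reaching furthest to the right
  obtain ⟨jm, hjm, hmax⟩ := (Finset.range (J + 1)).exists_max_image (fun j => c j 0) ⟨0, by simp⟩
  have hjmJ : jm ≤ J := hmemJ.1 hjm
  -- among the left feet joined to its right foot, the one furthest to the left
  obtain ⟨jl, hjl, hmin⟩ := ((Finset.range (J + 1)).filter (fun j => ω ∈ openConnIn S (a j) (c jm))).exists_min_image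
    (fun j => a j 0) ⟨jm, Finset.mem_filter.2 ⟨hjm, hconn jm hjmJ⟩⟩
  obtain ⟨hjl', hjlconn⟩ := Finset.mem_filter.1 hjl
  have hjlJ : jl ≤ J := hmemJ.1 hjl'
  refine ⟨a jl, c jm, ?_, (hc0 J le_rfl).trans (hmax J (hmemJ.2 le_rfl)), hjlconn⟩
  by_contra hlam
  push Not at hlam
  obtain ⟨P, hPS, hPω⟩ := exists_walk_of_mem_openConnIn hω hjlconn
  -- an arch whose left foot is left of `a jl` has its right foot left of `a jl`
  have key : ∀ j ≤ J, a j 0 < a jl 0 → c j 0 < a jl 0 := by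
    intro j hj haj
    have hnot : ω ∉ openConnIn S (a j) (c jm) := fun h =>
      absurd (hmin j (Finset.mem_filter.2 ⟨hmemJ.2 hj, h⟩)) (not_le.2 haj)
    by_contra hcj
    push Not at hcj
    have hcmax : c j 0 ≤ c jm 0 := hmax j (hmemJ.2 hj)
    rcases hcj.lt_or_eq with hlt | heq
    · rcases hcmax.lt_or_eq with hlt' | heq'
      · -- interleaved feet: the arch meets the walk from `a jl` to `c jm`
        obtain ⟨Q, hQS, hQω⟩ := exists_walk_of_mem_openConnIn hω (hconn j hj)
        obtain ⟨z, hzQ, hzP⟩ := hAr lo (a j) (c j) (a jl) (c jm) Q P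
          (fun z hz => hS z (hQS z hz)) (fun z hz => hS z (hPS z hz))
          (ha1 j hj) (hc1 j hj) (ha1 jl hjlJ) (hc1 jm hjmJ) haj hlt hlt'
        refine hnot ?_
        have h1 := mem_openConnIn_of_mem_support Q hQS hQω hzQ
        have h2 := mem_openConnIn_of_mem_support P hPS hPω hzP
        rw [openConnIn_comm] at h2
        exact PlanarDuality.openConnIn_trans h1 (PlanarDuality.openConnIn_trans h2 hjlconn)
      · -- same right foot
        have hcc : c j = c jm := Site.eq_iff_two.2 ⟨heq', by rw [hc1 j hj, hc1 jm hjmJ]⟩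
        exact hnot (hcc ▸ hconn j hj)
    · -- the right foot of the arch is `a jl`
      have hca : c j = a jl := Site.eq_iff_two.2 ⟨heq.symm, by rw [hc1 j hj, ha1 jl hjlJ]⟩
      have h1 : ω ∈ openConnIn S (a j) (a jl) := hca ▸ hconn j hj
      exact hnot (PlanarDuality.openConnIn_trans h1 hjlconn)
  -- inductively every right foot is left of `a jl`
  have hall : ∀ j ≤ J, c j 0 < a jl 0 := by
    intro j
    induction j with
    | zero =>
      intro h0
      have := ha0 0 h0
      exact key 0 h0 (by push_cast at this; linarith)
    | succ j ih =>
      intro hj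
      have h1 := ih (Nat.le_of_succ_le hj)
      have h2 := ha0 (j + 1) hj
      have h3 := hc0 j (Nat.le_of_succ_le hj)
      exact key (j + 1) hj (by push_cast at h2; linarith)
  -- which is absurd for the arch reaching furthest to the right
  have h1 := hall jm hjmJ
  have h2 : a jl 0 ≤ a jm 0 := hmin jm (Finset.mem_filter.2 ⟨hjm, hconn jm hjmJ⟩)
  have h3 := ha0 jm hjmJ
  have h4 := hc0 jm hjmJ
  linarith

/-! ### Translated arch events -/

/-- **Intersected translates of the arch event give a long connection** (pathwise form of the
first case of [KohlerSchindlerTassion2023, Lemma 1], Fig. 6 left): if the translates by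
`(jke, 0)`, `j = 0, …, J`, of the arch event of `[L, R] × [B, T]` (bottom segments at abscissae
`≤ xl` and `≥ xr`, `xl + ke < xr`) all occur, then the strip `{B ≤ x₁ ≤ T}` contains an open
connection from `{x₀ ≤ xl}` to `{xr + Jke ≤ x₀}`.
[cite: KohlerSchindlerTassion2023, §3, proof of Lemma 1 (first case, Fig. 6)] -/
theorem exists_openConnIn_of_iInter_arches (hAr : ArchesMeet) {ω : BondConfig (Site 2)}
    (hω : ω ⊆ (zdGraph 2).edgeSet) {L R B T xl xr : ℤ} {e J : ℕ} (hlr : xl < xr)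
    (hs : xl + k * e < xr)
    (h : ω ∈ ⋂ j ∈ Finset.range (J + 1),
      openCrossing (Site.shift ((k : ℤ) • ![(j : ℤ) * e, 0]) '' rect L R B T)
        (Site.shift ((k : ℤ) • ![(j : ℤ) * e, 0]) '' {y | y ∈ rect L R B T ∧ y 1 = B ∧ y 0 ≤ xl})
        (Site.shift ((k : ℤ) • ![(j : ℤ) * e, 0]) '' {y | y ∈ rect L R B T ∧ y 1 = B ∧ xr ≤ y 0})) :
    ∃ x y, x 0 ≤ xl ∧ xr + J * (k * e) ≤ y 0 ∧ ω ∈ openConnIn {z : Site 2 | B ≤ z 1 ∧ z 1 ≤ T} x y := by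
  have hF : ∀ j ∈ Finset.range (J + 1), ∃ x y : Site 2, (x 1 = B ∧ x 0 ≤ xl + j * (k * e)) ∧
      (y 1 = B ∧ xr + j * (k * e) ≤ y 0) ∧ ω ∈ openConnIn {z : Site 2 | B ≤ z 1 ∧ z 1 ≤ T} x y := by
    intro j hj
    obtain ⟨x, ⟨x', hx', rfl⟩, y, ⟨y', hy', rfl⟩, hxy⟩ := Set.mem_iInter₂.1 h j hj
    refine ⟨_, _, ?_, ?_, openConnIn_mono ?_ _ _ hxy⟩
    · have h1 := hx'.2.1; have h2 := hx'.2.2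
      simp only [Site.shift_apply, Pi.add_apply, Pi.smul_apply, smul_eq_mul, Matrix.cons_val_zero,
        Matrix.cons_val_one, mul_zero, add_zero]
      exact ⟨h1, by nlinarith⟩
    · have h1 := hy'.2.1; have h2 := hy'.2.2
      simp only [Site.shift_apply, Pi.add_apply, Pi.smul_apply, smul_eq_mul, Matrix.cons_val_zero,
        Matrix.cons_val_one, mul_zero, add_zero]
      exact ⟨h1, by nlinarith⟩
    · rw [image_shift_rect]
      intro z hz
      simp only [mem_rect, Pi.smul_apply, smul_eq_mul, Matrix.cons_val_zero, Matrix.cons_val_one, mul_zero,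
        add_zero] at hz
      exact ⟨hz.2.2.1, hz.2.2.2⟩
  choose! a c ha hc hconn using hF
  have hmemJ : ∀ {j}, j ∈ Finset.range (J + 1) ↔ j ≤ J := by simp
  exact exists_openConnIn_of_arches hAr hω (S := {z : Site 2 | B ≤ z 1 ∧ z 1 ≤ T}) (lo := B)
    (fun z hz => hz.1) (p := xl) (q := xr) (s := k * e) hlr hs (J := J)
    (fun j hj => (ha j (hmemJ.2 hj)).1) (fun j hj => (hc j (hmemJ.2 hj)).1)
    (fun j hj => (ha j (hmemJ.2 hj)).2) (fun j hj => (hc j (hmemJ.2 hj)).2)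
    (fun j hj => hconn j (hmemJ.2 hj))

/-- **FKG lower bound for intersected `kℤ²`-translates**: for an open crossing event `𝓕` and its
translates by `(jke, 0)`, `j = 0, …, J`, `μ(𝓕)^(J+1) ≤ μ(⋂ⱼ 𝓕ⱼ)` (translation invariance and
positive association). [cite: KohlerSchindlerTassion2023, §3, proof of Lemma 1 (first case)] -/
theorem pow_le_real_iInter_shift [IsProbabilityMeasure μ] (hμ : Admissible k t μ)
    (S A A' : Set (Site 2)) (e : ℕ) (J : ℕ) :
    μ.real (openCrossing S A A') ^ (J + 1) ≤
      μ.real (⋂ j ∈ Finset.range (J + 1),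
        openCrossing (Site.shift ((k : ℤ) • ![(j : ℤ) * e, 0]) '' S)
          (Site.shift ((k : ℤ) • ![(j : ℤ) * e, 0]) '' A) (Site.shift ((k : ℤ) • ![(j : ℤ) * e, 0]) '' A')) := by
  have hprod : μ.real (openCrossing S A A') ^ (J + 1) =
      ∏ j ∈ Finset.range (J + 1), μ.real (openCrossing (Site.shift ((k : ℤ) • ![(j : ℤ) * e, 0]) '' S)
        (Site.shift ((k : ℤ) • ![(j : ℤ) * e, 0]) '' A) (Site.shift ((k : ℤ) • ![(j : ℤ) * e, 0]) '' A')) := by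
    rw [← Finset.card_range (J + 1), ← Finset.prod_const, Finset.card_range]
    refine Finset.prod_congr rfl fun j _ => ?_
    exact (real_openCrossing_image (hμ.shift_inv ![(j : ℤ) * e, 0]) S A A').symm
  rw [hprod]
  exact prod_le_real_iInter hμ _ (fun j _ => isUpperSet_openCrossing _ _ _)
    fun j _ => measurableSet_openCrossing_of_countable _ _ _

end KSTPeriodic

end

end Literature.Probability.Percolation
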